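import Mathlib
import Summits.NavierStokesRegularity.NavierStokesRegularity.Theorems.EulerZoomLiouvillePowerGaugeEulerLiouvilleChiralAnchorRaceFinal
import Summits.NavierStokesRegularity.NavierStokesRegularity.Theorems.EulerZoomLiouvillePowerGaugeEulerLiouvilleChiralAnchorShellFloor
import Summits.NavierStokesRegularity.NavierStokesRegularity.Theorems.EulerZoomLiouvillePowerGaugeEulerLiouvilleChiralAnchorFarVolume
import HarnessLib

/-!
# Crux `EulerZoomLiouville.PowerGaugeEulerLiouville` (stmt-NavierStokesRegularity-19832), width sub-line `chiral_anchor` (ns-idea-11 g10):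
# THE MEMBER — the chiral-tube stratum of Seregin's class is EMPTY (every `ρ > 0`)

Seat ns-ezl-w3 g8 (`--supports stmt-NavierStokesRegularity-19832 --as helper`).  Composition BY NAME of the line's four proved stubs, all tree theorems:
K1 `ChiralAnchor.stub_anchorFlow_filler` (p711242, this seat), K2 `ChiralAnchor.shellHelicityFloor` (ns-ezl-w1 g9, proof by ns-idea-11 g10),
K3 `ChiralAnchor.farVolumeBound` (ns-ezl-w1 g9, proof by ns-idea-11 g10), K4 `ChiralAnchor.stub_anchorRace_filler` (this seat):
★ `ChiralAnchor.chiralTubePast_absurd : 0 < ρ → InClass ρ u p H c → IsChiralTubePast u p → False` with `InClass` / `IsChiralTubePast` of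
`Lines/chiral_anchor.lean` (= LEAD skeleton `Lines/birth.lean` v112 predicates) δ-unfolded VERBATIM — the shape of the LEAD's wiring contract
(10:19:51Z / 09:26:11Z: `¬ IsChiralTubePast u p` replaces `¬ IsHelicalTubePast ρ u p` in `stub_nonSelfSimilarRest`).

HONEST FRAMING: one stratum (classical members with a slab velocity bound before an anchor time and a tube datum of non-zero Moffatt helicity) of the
MODEL-lattice crux class is emptied; the crux's open complement (the line's K6) is untouched; nothing about the crux E (19832 OPEN) or NS
regularity is proved; not E. [cite: Moffatt1969, §3; CaffarelliKohnNirenberg1982, §2]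
-/

noncomputable section

set_option linter.dupNamespace false

open MeasureTheory Set Filter Topology Metric Function InnerProductSpace
open scoped RealInnerProductSpace NNReal ENNReal ContDiff Topology

namespace Summit.NavierStokesRegularity.NavierStokesRegularity.Theorems.PowerGaugeEulerLiouville.ChiralAnchor

open Literature.Analysis Literature.Analysis.FluidPDE
open Summit.NavierStokesRegularity.NavierStokesRegularity.Theorems.PowerGaugeEulerLiouville

/-- ★ **THE CHIRAL-TUBE STRATUM IS EMPTY**: for every `ρ > 0`, no `(u,p,H)` of Seregin's power-gauged class (`InClass ρ u p H c`, δ-unfolded) lies in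
the chiral-tube stratum (`IsChiralTubePast u p`, δ-unfolded) — K4 ∘ (K2, K3, K1).  LEAD: `exact ChiralAnchor.chiralTubePast_absurd ρ hρ u p H c hcls hs`.
[cite: Moffatt1969, §3; CaffarelliKohnNirenberg1982, §2] -/
theorem chiralTubePast_absurd (ρ : ℝ) (hρ : 0 < ρ)
    (u : ℝ → (EuclideanSpace ℝ (Fin 3)) → (EuclideanSpace ℝ (Fin 3))) (p : ℝ → (EuclideanSpace ℝ (Fin 3)) → ℝ) (H : ℝ → (EuclideanSpace ℝ (Fin 3)) → (EuclideanSpace ℝ (Fin 3)) →L[ℝ] (EuclideanSpace ℝ (Fin 3))) (c : ℝ≥0)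
    (hcls : Literature.Analysis.FluidPDE.IsSuitableWeakSolutionOn
      (Literature.Analysis.FluidPDE.slab (EuclideanSpace ℝ (Fin 3)) (Set.Iio 0) isOpen_Iio) 0 0 u p ∧
    Literature.Analysis.FluidPDE.HasWeakSpatialGradientOn
      (Literature.Analysis.FluidPDE.slab (EuclideanSpace ℝ (Fin 3)) (Set.Iio 0) isOpen_Iio) u H ∧
    (∀ a : ℝ, 0 < a →
      ENNReal.ofReal (a ^ (2 * ρ)) * Literature.Analysis.FluidPDE.cknA a (0 : ℝ × (EuclideanSpace ℝ (Fin 3))) u +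
          ENNReal.ofReal (a ^ ρ) * Literature.Analysis.FluidPDE.cknE a (0 : ℝ × (EuclideanSpace ℝ (Fin 3))) H +
        ENNReal.ofReal (a ^ (2 * ρ)) * Literature.Analysis.FluidPDE.cknD a (0 : ℝ × (EuclideanSpace ℝ (Fin 3))) p ≤ (c : ℝ≥0∞)))
    (hct : Literature.Analysis.FluidPDE.IsClassicalEulerSolutionOn (Set.Iio 0) 0 u p ∧
    ∃ t₀ : ℝ, t₀ < 0 ∧
      (∀ t₁ : ℝ, t₁ < t₀ → ∃ B : ℝ, ∀ r ∈ Set.Icc t₁ t₀, ∀ x : (EuclideanSpace ℝ (Fin 3)), ‖u r x‖ ≤ B) ∧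
      ∃ (χ : (EuclideanSpace ℝ (Fin 3)) → ℝ) (R : ℝ), 0 < R ∧ (ContDiff ℝ ∞ χ ∧ (∀ x : (EuclideanSpace ℝ (Fin 3)), |χ x| ≤ 1) ∧ (∀ x : (EuclideanSpace ℝ (Fin 3)), R ≤ ‖x‖ → χ x = 0) ∧
    ∀ x : (EuclideanSpace ℝ (Fin 3)), fderiv ℝ χ x (Literature.Analysis.FluidPDE.curl (u t₀) x) = 0) ∧ (∫ x, χ x * inner ℝ (u t₀ x) (Literature.Analysis.FluidPDE.curl (u t₀) x)) ≠ 0) : False :=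
  stub_anchorRace_filler shellHelicityFloor farVolumeBound ρ hρ u p H c hcls hct (stub_anchorFlow_filler u p hct.1)

end Summit.NavierStokesRegularity.NavierStokesRegularity.Theorems.PowerGaugeEulerLiouville.ChiralAnchor

end
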